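import Mathlib
import HarnessLib

/-!
# ChargedEnergyGap · cut-locus support (lens-3 g73, for door [K₁-CHARGE] of NODE 73 «OctahedralLedger»)

The geometric heart of the charging half (K₁b) of the onset crux (K₁ᴴ) `OctShellHQ` (part E): FOLDED sites of the localisation weight
`w = W(dist(·, C))` lie on the cut locus of the distance function, and every point `y` OWNS the open minimising segments toward its feet, on
which the distance function is affine and the foot is UNIQUE (so no fold passes there).  Stated in any real normed space, the uniqueness in any STRICTLY CONVEX one (inner product spaces, `E3`):

* `IsFoot C y p` — `p ∈ C` realises `dist y p = infDist y C`;
* `infDist_eq_of_mem_segment` — along a minimising segment `[y, p]` the distance to `C` decreases affinely: `infDist z C = infDist y C − dist y z`;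
* `IsFoot.of_mem_segment` — the foot of `y` is a foot of every point of its minimising segment;
* `IsFoot.eq_of_mem_openSegment` — ★ on the OPEN minimising segment the foot is unique (equality in the triangle inequality in a strictly convex
  space forces collinearity: `dist_add_dist_eq_iff`);
* `ball_subset_ball_of_mem_segment` — the clearance ball of a segment point sits inside that of `y`: `ball z (infDist y C − dist y z) ⊆ ball y (infDist y C)`,
  and both miss `C`.
Mathlib only; no `sorry`; no instances.
-/

noncomputable section

namespace Summit.AtomisticToContinuum.Crystallization.Theorems.ChargedEnergyGapCutLocus

section Metric

variable {E : Type*} [PseudoMetricSpace E]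

/-- `p` is a FOOT (nearest point) of `y` on the set `C`. -/
def IsFoot (C : Set E) (y p : E) : Prop :=
  p ∈ C ∧ dist y p = Metric.infDist y C

variable {C : Set E} {y p z p' : E}

/-- `IsFoot.mem` (docstring added by the landing lane; see the module docstring). [formal bookkeeping] -/
theorem IsFoot.mem (h : IsFoot C y p) : p ∈ C := h.1

/-- `IsFoot.dist_eq` (docstring added by the landing lane; see the module docstring). [formal bookkeeping] -/
theorem IsFoot.dist_eq (h : IsFoot C y p) : dist y p = Metric.infDist y C := h.2

/-- A point of `C` is its own (unique) foot. -/
theorem isFoot_self (hy : y ∈ C) : IsFoot C y y :=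
  ⟨hy, by rw [dist_self, Metric.infDist_zero_of_mem hy]⟩

/-- A foot is at least as close as any point of `C`. -/
theorem IsFoot.dist_le (h : IsFoot C y p) (hq : p' ∈ C) : dist y p ≤ dist y p' := by
  rw [h.2]; exact Metric.infDist_le_dist_of_mem hq

/-- The clearance ball of a segment point sits inside that of `y`. -/
theorem ball_subset_ball_of_dist_le (y z : E) (R : ℝ) : Metric.ball z (R - dist y z) ⊆ Metric.ball y R := by
  intro x hx
  rw [Metric.mem_ball] at hx ⊢
  have := dist_triangle x z y
  rw [dist_comm z y] at this
  linarith

/-- … and the clearance ball of `y` misses `C`. -/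
theorem ball_infDist_disjoint (C : Set E) (y : E) : Disjoint (Metric.ball y (Metric.infDist y C)) C := by
  rw [Set.disjoint_left]
  intro x hx hxC
  rw [Metric.mem_ball] at hx
  have := Metric.infDist_le_dist_of_mem (x := y) hxC
  rw [dist_comm] at this
  linarith

end Metric

section Normed

variable {E : Type*} [NormedAddCommGroup E] [NormedSpace ℝ E] {C : Set E} {y p z p' : E}

/-- Along a minimising segment the distance to `C` decreases AFFINELY. -/
theorem infDist_eq_of_mem_segment (h : IsFoot C y p) (hz : z ∈ segment ℝ y p) :
    Metric.infDist z C = Metric.infDist y C - dist y z := by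
  have h1 : dist y z + dist z p = dist y p := dist_add_dist_of_mem_segment hz
  have h2 : Metric.infDist z C ≤ dist z p := Metric.infDist_le_dist_of_mem h.1
  have h3 : Metric.infDist y C ≤ Metric.infDist z C + dist y z := Metric.infDist_le_infDist_add_dist
  have h4 := h.2
  linarith

/-- The foot of `y` is a foot of every point of the minimising segment. -/
theorem IsFoot.of_mem_segment (h : IsFoot C y p) (hz : z ∈ segment ℝ y p) : IsFoot C z p := by
  refine ⟨h.1, ?_⟩
  have h0 := infDist_eq_of_mem_segment h hz
  have h1 : dist y z + dist z p = dist y p := dist_add_dist_of_mem_segment hz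
  have h2 := h.2
  linarith

end Normed

section Strict

variable {E : Type*} [NormedAddCommGroup E] [NormedSpace ℝ E] [StrictConvexSpace ℝ E] {C : Set E} {y p z p' : E}

/-- ★ UNIQUE FOOT ON OPEN MINIMISING SEGMENTS: if `p` is a foot of `y` and `z` lies strictly between `y` and `p`, then `p` is the ONLY foot of `z`
(cut loci miss open minimising segments).  Equality in the triangle inequality `dist y p' ≤ dist y z + dist z p'` forces `z ∈ [y, p']`
(`dist_add_dist_eq_iff`, strict convexity), and two points beyond `z` on rays from `y` through `z` at the same distance from `z` coincide. -/
theorem IsFoot.eq_of_mem_openSegment (h : IsFoot C y p) (hz : z ∈ openSegment ℝ y p) (h' : IsFoot C z p') : p' = p := by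
  have hzs : z ∈ segment ℝ y p := openSegment_subset_segment ℝ y p hz
  have hzp : IsFoot C z p := h.of_mem_segment hzs
  have hd : dist z p' = dist z p := by rw [h'.2, hzp.2]
  have h1 : dist y z + dist z p = dist y p := dist_add_dist_of_mem_segment hzs
  have h4 : dist y p ≤ dist y p' := h.dist_le h'.1
  have htri : dist y p' ≤ dist y z + dist z p' := dist_triangle y z p'
  have heq : dist y z + dist z p' = dist y p' := by linarith
  have hw : Wbtw ℝ y z p' := dist_add_dist_eq_iff.mp heq
  -- parametrise both segments from `y`
  rw [openSegment_eq_image_lineMap] at hz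
  obtain ⟨t, ⟨ht0, ht1⟩, rfl⟩ := hz
  obtain ⟨s, ⟨hs0, hs1⟩, hsz⟩ := hw
  rw [AffineMap.lineMap_apply_module'] at hsz hd h1 heq
  -- the two parametrisations of `z`
  have hv : s • (p' - y) = t • (p - y) := by
    have := hsz; exact add_right_cancel this
  -- norms along the two rays
  have hn1 : dist (t • (p - y) + y) p = (1 - t) * ‖p - y‖ := by
    rw [dist_eq_norm, show t • (p - y) + y - p = -((1 - t) • (p - y)) by module, norm_neg, norm_smul,
      Real.norm_eq_abs, abs_of_nonneg (by linarith)]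
  have hn2 : dist (t • (p - y) + y) p' = (1 - s) * ‖p' - y‖ := by
    rw [← hv, dist_eq_norm, show s • (p' - y) + y - p' = -((1 - s) • (p' - y)) by module, norm_neg, norm_smul,
      Real.norm_eq_abs, abs_of_nonneg (by linarith)]
  have hn3 : s * ‖p' - y‖ = t * ‖p - y‖ := by
    have := congrArg (fun v : E => ‖v‖) hv
    simp only [norm_smul, Real.norm_eq_abs, abs_of_nonneg hs0, abs_of_nonneg ht0.le] at this
    exact this
  rw [hn1, hn2] at hd
  -- hence ‖p' - y‖ = ‖p - y‖ and s = t (or the degenerate p = y = p')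
  have hL : ‖p' - y‖ = ‖p - y‖ := by linarith
  by_cases hpy : ‖p - y‖ = 0
  · have hp : p = y := by rwa [norm_eq_zero, sub_eq_zero] at hpy
    have hp' : p' = y := by rw [hpy, norm_eq_zero, sub_eq_zero] at hL; exact hL
    rw [hp, hp']
  · have hst : s = t := by
      rw [hL] at hn3
      exact mul_right_cancel₀ hpy hn3
    rw [hst] at hv
    have := smul_right_injective E (ne_of_gt ht0) hv
    -- p' - y = p - y
    exact sub_left_injective this

end Strict

end Summit.AtomisticToContinuum.Crystallization.Theorems.ChargedEnergyGapCutLocus
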